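import Summits.QuantumFields.YangMills.Theorems.BalabanUVNodesPortS1HalvesDefs
import Summits.QuantumFields.YangMills.Theorems.BalabanUVNodesPortS1ResidueWAdd
import Summits.QuantumFields.YangMills.Theorems.BalabanUVNodesPortS1SplitGerm
import Summits.QuantumFields.YangMills.Theorems.BalabanUVNodesPortS1Spaces
import Summits.QuantumFields.YangMills.Theorems.BalabanUVNodesPortHRecordJoinDefs

/-!
# NODE O port PT-A — THE GLUE OF THE TWO HALVES: 27930⁸-Ax-LR4 (`PortHRecordJoin.Sig8LR4 F` for every `F`, = the route decl `Theses.BalabanUVNodes.PortRecordRepresentationS1` by `Iff.rfl`)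
# ⟸ `PortRecordLZHalf F` ([16] (63): the `log Z^{(k)}` bracket has a wrap-aware residue) + `PortRecordFEHalf F` ([I] (2.12)–(2.14) + [II]: the remainder has one), for every `F`

Cell `ym-nodeO-ideate`, porter seat `ymgap-nodeO-port-PTA-1` (gen 4); `--supports stmt-QuantumFields-27930` (helper).  [I] = [Balaban1987RG1], [II] = [Balaban1988RG2Cluster].  The composition
of the line skeleton `Cruxes/PortRecordRepresentationS1/Lines/pta-residueW.lean` (stubs `stub_LZ : ∀ F, PortRecordLZHalf F`, `stub_FE : ∀ F, PortRecordFEHalf F`).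
* §1 `residueAtW_anti_radii` — `ResidueAtW` is antitone in the radii `(α₀, α₁)` (`recordUc_mono`): two halves with different radii meet at `min` (the `κ`-twin is `…SplitGerm.residueAtW_mono`).
* §2 ★★★ `sig27930v8LR4_of_halves` — `Mth := max`, `κ := min`, radii `:= min`, `E₀ := E₁ + E₂`, `ε₂₉, γ₀` from the FE half (the LZ half holds at every `ε₂₉ > 0` and is flow-free), split
  `recordΦfAx = phiLZ + phiFE` by construction (`phiLZ_add_phiFE`), into `…ResidueWAdd.sig27930v8LR4_of_residueAtW₂`.

HONEST FRAMING.  Bookkeeping; neither half is proved here (both are OPEN: LZ conditional on NODE O's leaves, FE = print's §2–§5 + [II], XXL); 27930 OPEN; K0⁷∕K-Ax OPEN; NODE O 0∕1;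
COUNT 8∕28 · K 1∕4 UNMOVED; finite `𝕋⁴_{L^K}` at fixed ε — NOT continuum ∕ OS ∕ Clay; **the Yang–Mills mass gap is NOT proved by any of this.**  No `sorry`, no `def`, no `instance`.
-/

noncomputable section

open scoped BigOperators Matrix.Norms.L2Operator Topology

namespace Summit.QuantumFields.YangMills.Theorems.BalabanUVNodesPortS1

open Summit.QuantumFields.YangMills.Theorems.K0RecordFormatNames
open Literature.MathematicalPhysics.QuantumFieldTheory.Balaban1983to89
open Literature.MathematicalPhysics.QuantumFieldTheory.Balaban1983to89.Node00
open Literature.MathematicalPhysics.QuantumFieldTheory.Balaban1983to89.T4Continuum (T4Family)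
open _root_.Filter

section Radii

variable (F : T4Family)

variable {F} in
/-- **The wrap-aware residue is ANTITONE in the radii**: rows (a)(b) (off- and on-wrap) quantify over pairs of `recordUc … α₀ α₁ … X`, which SHRINKS with the radii (`recordUc_mono`); (c)(d)(f′)
do not read them.  So two halves with different radii meet at `min`. [cite: Balaban1987RG1, p.263 L5–13, (1.18) p.263 (bookkeeping)] -/
theorem residueAtW_anti_radii {Mc k : ℕ} {Ψ : IntLocalFormula (F.L ^ (k + 1) * Mc)} {Ew : TorusPieces F Mc k} {a₀ ε₂₉ α₀ α₀' α₁ α₁' E₀ κ : ℝ}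
    {Φf : (n : ℕ) → recordW F a₀ ε₂₉ k (recordK₀ F Mc k + n) → ℂ}
    (h : Ψ.ResidueAtW F Mc k Ew a₀ ε₂₉ α₀ α₁ E₀ κ Φf) (h₀ : α₀' ≤ α₀) (h₁ : α₁' ≤ α₁) :
    Ψ.ResidueAtW F Mc k Ew a₀ ε₂₉ α₀' α₁' E₀ κ Φf := by
  obtain ⟨hA, hB, hEA, hEB, hEL, hEG, hR⟩ := h
  have sub : ∀ (n : ℕ) (X : (recordDomSys F Mc k (recordK₀ F Mc k + n)).Dom),
      recordUc F Mc k α₀' α₁' (recordK₀ F Mc k + n) X ⊆ recordUc F Mc k α₀ α₁ (recordK₀ F Mc k + n) X :=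
    fun n X => recordUc_mono F Mc k (recordK₀ F Mc k + n) X h₀ h₁
  exact ⟨fun n X hX φ hφ => hA n X hX φ (sub n X hφ), fun n X hX φ hφ => hB n X hX φ (sub n X hφ),
    fun n X hX φ hφ => hEA n X hX φ (sub n X hφ), fun n X hX φ hφ => hEB n X hX φ (sub n X hφ), hEL, hEG, hR⟩

end Radii

/-- ★★★ **27930⁸-Ax-LR4 FROM ITS TWO HALVES**: the LZ half (`PortRecordLZHalf`, flow-free, every `ε₂₉ > 0`) and the FE half (`PortRecordFEHalf`, picks `γ₀, ε₂₉`) for every torus family give the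
signed text `Sig8LR4 F` for every `F` (`= Theses.BalabanUVNodes.PortRecordRepresentationS1` by `Iff.rfl`; route file deliberately not imported, docket O-8).  Assembly: `Mth := max`, `κ := min`,
radii `:= min` (`residueAtW_mono`, `residueAtW_anti_radii`), `E₀ := E₁ + E₂` and the split `recordΦfAx = phiLZ + phiFE` (`phiLZ_add_phiFE`, by construction) into
`sig27930v8LR4_of_residueAtW₂`. [cite: Balaban1987RG1, (2.12)–(2.14) p.268, Thm 3 p.264; Balaban1988RG2Cluster, p.21] -/
theorem sig27930v8LR4_of_halves (hLZ : ∀ F, PortRecordLZHalf F) (hFE : ∀ F, PortRecordFEHalf F) :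
    ∀ F, Summit.QuantumFields.YangMills.Theorems.PortHRecordJoin.Sig8LR4 F := by
  refine sig27930v8LR4_of_residueAtW₂ fun F => ?_
  obtain ⟨M₁, H₁⟩ := hLZ F
  obtain ⟨M₂, H₂⟩ := hFE F
  refine ⟨max M₁ M₂, fun Mc hMc j c c₀ c₁ B₃ B₃' a₀ a₁ hG h₁ h₂ h₃ h₄ h₅ h₆ h₇ hT8 hT9 hTE hP9 hP9L => ?_⟩
  obtain ⟨γ₀, ε₂₉, E₂, κ₂, β₀, β₁, hγ, hε, hE₂, hκ₂, hβ₀, hβ₁, HFE⟩ :=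
    H₂ Mc (le_of_max_le_right hMc) j c c₀ c₁ B₃ B₃' a₀ a₁ hG h₁ h₂ h₃ h₄ h₅ h₆ h₇ hT8 hT9 hTE hP9 hP9L
  obtain ⟨E₁, κ₁, α₀, α₁, hE₁, hκ₁, hα₀, hα₁, HLZ⟩ :=
    H₁ Mc (le_of_max_le_left hMc) j c c₀ c₁ B₃ B₃' a₀ a₁ hG h₁ h₂ h₃ h₄ h₅ h₆ h₇ hT8 hT9 hTE hP9 hP9L ε₂₉ hε
  refine ⟨γ₀, ε₂₉, E₁, E₂, min κ₁ κ₂, min α₀ β₀, min α₁ β₁, hγ, hε, hE₁, hE₂, le_min hκ₁ hκ₂, lt_min hα₀ hβ₀, lt_min hα₁ hβ₁,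
    fun k g hflow hint => ?_⟩
  obtain ⟨Ψ₁, Ew₁, hR₁⟩ := HLZ k
  obtain ⟨Ψ₂, Ew₂, hR₂⟩ := HFE k g hflow hint
  refine ⟨phiLZ F Mc a₀ ε₂₉ k, phiFE F Mc a₀ ε₂₉ k (FlowStep.prefixOf g k), Ψ₁, Ψ₂, Ew₁, Ew₂,
    residueAtW_anti_radii (residueAtW_mono hR₁ le_rfl (min_le_left _ _) hE₁) (min_le_left _ _) (min_le_left _ _),
    residueAtW_anti_radii (residueAtW_mono hR₂ le_rfl (min_le_right _ _) hE₂) (min_le_right _ _) (min_le_right _ _),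
    fun n => Eventually.of_forall fun B => phiLZ_add_phiFE F Mc a₀ ε₂₉ k (FlowStep.prefixOf g k) n B⟩

end Summit.QuantumFields.YangMills.Theorems.BalabanUVNodesPortS1

end
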